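import Literature.AlgebraicGeometry.Resolution.ArithmeticalThreefoldsLocalFrameStep
import HarnessLib

/-!
# Cossart–Piltant's local theorem: the two multiplicity cases of Cor. 5.2 as named pieces

Topic: `Literature/AlgebraicGeometry/Resolution`. Fact-decomposition file (librarian, mode
`fact-decompose`, 2026-08-16) for the named fact
`Literature.AlgebraicGeometry.Resolution.CossartPiltant2019Local` (`ArithmeticalThreefoldsLocal.lean`;
V. Cossart, O. Piltant, *Resolution of singularities of arithmetical threefolds*, J. Algebra 529
(2019) 268–535 = arXiv:1412.0868, journal Thm. 1.5 = arXiv v1 Thm. 1.4, weak local-uniformization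
form).

The tree has PROVED (`ArithmeticalThreefoldsLocalInField.lean`, `…Reduction.lean`,
`…Chart.lean`, `…FrameStep.lean`) that the fact follows from its *in-field, normal-form* version
split along the two cases of the paper's **Corollary 5.2** (arXiv v1 p. 58: "[Thm. 1.4] is then an
immediate consequence of [CoP4] Main Theorem 1.3 (`m(x) < p`), theorem 2.23 (`(m(x), ω(x)) = (p, 0)`)
and theorem 5.1 [the Projection Theorem]"): `CossartPiltant2019Local.of_inField_cases Hlt Heq`.
This file NAMES the two hypotheses of that theorem, which are two distinct published results, and
records the assembly:

* `CossartPiltant2014_localUniformization_multiplicityLt` — the case **`m(x) < p`**: local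
  uniformization at a singular rational normal-form frame `(R ⊆ L, h, x, 𝒪_μ)` with
  `h ≡ X^p mod 𝔪_R`, `h(0) ∈ 𝔪_R²` and SOME coefficient `(h)_i ∉ 𝔪_R^{p-i}` (`ord_x h < p`). This
  is Cossart–Piltant, *Resolution of singularities of threefolds in mixed characteristic: case of
  small multiplicity*, RACSAM 108 (2014) 113–151 (= [CoP4] of the 2019 paper), **Main Theorem 1.3**
  (resolution / local uniformization of `Spec S[X]/(h)` at points of multiplicity `< p`), in the
  in-field frame language of the tree.
* `CossartPiltant2019_localUniformization_multiplicityEq` — the case **`m(x) = p`**: the same with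
  ALL `(h)_i ∈ 𝔪_R^{p-i}` (`ord_x h = p`, i.e. `δ(x) ≥ 1`): Cossart–Piltant 2019, Thm. 2.23 (the
  case `ω(x) = 0`) with the **Projection Theorem 5.1** (Chapters 5–9: `ω(x) ≥ 1`).
* `CossartPiltant2019Local_holds_of` — PROVED assembly:
  `…multiplicityLt → …multiplicityEq → CossartPiltant2019Local`
  (`CossartPiltant2019Local.of_inField_cases`).

Neither child restates the parent: both live on in-field frames (subrings `R` of the one field `L`
carrying `𝒪_μ`, with (MIN)/(GEN) in place of `K = Frac S`, `L = K(x)`), in normal form with a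
singular rational centre, and each covers one multiplicity stratum only. The statements are the
hypotheses `Hlt`, `Heq` of `CossartPiltant2019Local.of_inField_cases` verbatim.

## References

* V. Cossart, O. Piltant, J. Algebra 529 (2019) 268–535 = arXiv:1412.0868: Thm. 1.4 (v1 p. 4),
  Thm. 2.23, Thm. 5.1, Cor. 5.2 (v1 p. 58). [CossartPiltant2019]
* V. Cossart, O. Piltant, *Resolution of singularities of threefolds in mixed characteristic: case
  of small multiplicity*, Rev. R. Acad. Cienc. Exactas Fís. Nat. Ser. A Mat. RACSAM 108 (2014)
  113–151, Main Theorem 1.3. [CossartPiltant2012]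
-/

noncomputable section

open IsLocalRing Polynomial

namespace Literature.AlgebraicGeometry.Resolution

universe u

/-- **Cossart–Piltant [CoP4] (RACSAM 108 (2014)), Main Theorem 1.3, in the in-field frame form
consumed by Cor. 5.2 of the 2019 paper: local uniformization at multiplicity `m(x) < p`.** For a
prime `p`, a field `L`, a subring `R ⊆ L` which is an excellent regular local ring of Krull
dimension `3` with residue field of characteristic `p`, a monic `h ∈ R[X]` of degree `p` with a
root `x ∈ L` satisfying (MIN) (no nonzero `g ∈ R[X]` of degree `< p` kills `x`) and (GEN) (every
`z ∈ L` is `g(x)/s`, `g ∈ R[X]`, `0 ≠ s ∈ R`), in case (i) `char L = p`, `h = X^p + f_p` or (ii)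
`|Aut_R(L)| = p` with `R[x]` stable, in NORMAL FORM `h ≡ X^p mod 𝔪_R`, `h(0) ∈ 𝔪_R²` (the
centre is the singular rational point `X = 0`) and with some `(h)_i ∉ 𝔪_R^{p-i}` (i.e.
`m(x) = ord_x h < p`, read off the coefficients by `ArithmeticalThreefoldsLocalProofs.lean`): for
every valuation ring `O ⊇ R` of `L` dominating `R` there is a finite `t ⊆ L` with `R[x][t] ⊆ O`
regular at the centre `𝔪_O ∩ R[x][t]`. Printed: "MAIN THEOREM 1.3" of [CoP4] resolves
`𝒳 = Spec S[X]/(h)` at points of multiplicity `< p` (quoted in CP 2019, Cor. 5.2: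
"[CoP4] Main Theorem 1.3 (`m(x) < p`)"); the weak local-uniformization rendering is that of
`CossartPiltant2019Local` (module docstring of `ArithmeticalThreefoldsLocal.lean`). This is the
hypothesis `Hlt` of `CossartPiltant2019Local.of_inField_cases`, verbatim.
[cite: CossartPiltant2012, Main Theorem 1.3] [cite: CossartPiltant2019, Cor. 5.2 (arXiv v1 p. 58)] -/
def CossartPiltant2014_localUniformization_multiplicityLt : Prop :=
  ∀ (p : ℕ), p.Prime → ∀ (L : Type u) [Field L] (R : Subring L) [IsRegularLocalRing R],
    IsExcellentRing R → ringKrullDim R = 3 → CharP (ResidueField R) p →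
    ∀ (h : R[X]) (x : L), h.Monic → h.natDegree = p → aeval x h = 0 →
    (∀ g : R[X], g.natDegree < p → aeval x g = 0 → g = 0) →
    (∀ z : L, ∃ (g : R[X]) (s : R), s ≠ 0 ∧ z * s = aeval x g) →
    ((CharP L p ∧ ∀ i, 0 < i → i < p → h.coeff i = 0) ∨
      (Nat.card (L ≃ₐ[R] L) = p ∧
        ∀ σ : L ≃ₐ[R] L, ∀ y ∈ Algebra.adjoin R ({x} : Set L),
          σ y ∈ Algebra.adjoin R ({x} : Set L))) →
    -- normal form, singular centre, `m(x) < p`: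
    (∀ i < p, h.coeff i ∈ maximalIdeal R) → h.coeff 0 ∈ maximalIdeal R ^ 2 →
    (∃ i, i < p ∧ h.coeff i ∉ maximalIdeal R ^ (p - i)) →
    ∀ (O : ValuationSubring L), R ≤ O.toSubring →
      (∀ r : R, r ∈ maximalIdeal R → O.valuation (r : L) < 1) →
      ∃ (t : Finset L) (ht : (Algebra.adjoin R (insert x (t : Set L))).toSubring ≤ O.toSubring),
        IsRegularLocalRing (Localization.AtPrime
          (Ideal.comap (Subring.inclusion ht) (maximalIdeal O)))

/-- **Cossart–Piltant 2019, Thm. 2.23 with the Projection Theorem 5.1 (Chapters 2–9), in the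
in-field frame form consumed by Cor. 5.2: local uniformization at multiplicity `m(x) = p`.** Same
frame data as `CossartPiltant2014_localUniformization_multiplicityLt`, but in normal form with ALL
`(h)_i ∈ 𝔪_R^{p-i}` for `i < p` (`m(x) = ord_x h = p`, equivalently `δ(x) ≥ 1`): for every
valuation ring `O ⊇ R` of `L` dominating `R` there is a finite `t ⊆ L` with `R[x][t] ⊆ O` regular at
the centre. Printed: Cor. 5.2, "theorem 2.23 (`(m(x), ω(x)) = (p, 0)`) and theorem 5.1"
(Projection Theorem: for `ω(x) ≥ 1` a finite sequence of Hironaka-permissible local blowing ups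
along `μ` lowers `(m(x), ω(x), κ(x))`; proved in Chapters 6–9). This is the hypothesis `Heq` of
`CossartPiltant2019Local.of_inField_cases`, verbatim; the weak local-uniformization rendering is
that of `CossartPiltant2019Local`.
[cite: CossartPiltant2019, Thm. 2.23, Thm. 5.1 and Cor. 5.2 (arXiv v1 p. 58)] -/
def CossartPiltant2019_localUniformization_multiplicityEq : Prop :=
  ∀ (p : ℕ), p.Prime → ∀ (L : Type u) [Field L] (R : Subring L) [IsRegularLocalRing R],
    IsExcellentRing R → ringKrullDim R = 3 → CharP (ResidueField R) p →
    ∀ (h : R[X]) (x : L), h.Monic → h.natDegree = p → aeval x h = 0 →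
    (∀ g : R[X], g.natDegree < p → aeval x g = 0 → g = 0) →
    (∀ z : L, ∃ (g : R[X]) (s : R), s ≠ 0 ∧ z * s = aeval x g) →
    ((CharP L p ∧ ∀ i, 0 < i → i < p → h.coeff i = 0) ∨
      (Nat.card (L ≃ₐ[R] L) = p ∧
        ∀ σ : L ≃ₐ[R] L, ∀ y ∈ Algebra.adjoin R ({x} : Set L),
          σ y ∈ Algebra.adjoin R ({x} : Set L))) →
    -- normal form with `m(x) = p` (`δ(x) ≥ 1`):
    (∀ i < p, h.coeff i ∈ maximalIdeal R ^ (p - i)) →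
    ∀ (O : ValuationSubring L), R ≤ O.toSubring →
      (∀ r : R, r ∈ maximalIdeal R → O.valuation (r : L) < 1) →
      ∃ (t : Finset L) (ht : (Algebra.adjoin R (insert x (t : Set L))).toSubring ≤ O.toSubring),
        IsRegularLocalRing (Localization.AtPrime
          (Ideal.comap (Subring.inclusion ht) (maximalIdeal O)))

/-- **Assembly (fact split): `CossartPiltant2019Local` from its two multiplicity cases** —
Cossart–Piltant 2019, Cor. 5.2: after normalisation at the frame the centre is the singular
rational point `X = 0` and `m(x) < p` or `m(x) = p`; the tree's
`CossartPiltant2019Local.of_inField_cases`. [cite: CossartPiltant2019, Cor. 5.2 (arXiv v1 p. 58)] -/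
theorem CossartPiltant2019Local_holds_of
    (hlt : CossartPiltant2014_localUniformization_multiplicityLt.{u})
    (heq : CossartPiltant2019_localUniformization_multiplicityEq.{u}) :
    CossartPiltant2019Local.{u} :=
  CossartPiltant2019Local.of_inField_cases hlt heq

end Literature.AlgebraicGeometry.Resolution

end
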